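import Summits.ResolutionOfSingularities.ResolutionOfSingularities.Theorems.PurelyInseparableDim4ChartAtlasSNCFarShear
import Summits.ResolutionOfSingularities.ResolutionOfSingularities.Theorems.PurelyInseparableDim4ChartAtlasSNCFarResonance
import Summits.ResolutionOfSingularities.ResolutionOfSingularities.Theorems.PurelyInseparableDim4ChartAtlasBoundary
import Summits.ResolutionOfSingularities.ResolutionOfSingularities.Theorems.PurelyInseparableDim4ChartAtlasReading
import HarnessLib

/-!
# Purely inseparable four-folds `z^p + F(x₁, …, x₄)`: the transformed boundary WITH FAR MEMBERS read on the charts of the S3-N1 atlas,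
# escaping case `j ∉ S'` — chart by chart it is snc with the escaping centre when no two active far members share a height (typ-2 g6)

[OURS · counted 0] (D-0157 DOOR 2; DR-157-C; desk WORD #115 (a)/(c), #131 (c); typ-2 g5 HANDOFF OPEN item 1). Old boundary
`E = [(xᵢ + cᵢ)·𝒪 : i ∈ ms] ++ [(xᵢ + dᵢ)·𝒪 : i ∈ fs]` — NEAR members (`c = 0` on `S`) and FAR members (`i ∈ S`, `dᵢ ≠ 0`); `π` ANY
blowing up of `𝔸⁵` along `V(z, x_S)`; the walk's point `b` on the `x_j`-chart (`b_j = 0`); next centre variables `S' ∌ j`. PROVED here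
(no `sorry`, no new axiom):

* §1 the FAR members read on a shear chart `x_l` (`τ x_l = x_l`): `{x_l = -d}` ↦ `(x_l + d)·𝒪`; `{x_j = -d}` ↦ `(x_j·x_l + d)·𝒪`;
  `{xᵢ = -d}`, `i ∈ S ∖ {j, l}` ↦ `((xᵢ + bᵢ·x_j)·x_l + d)·𝒪` (engine p696894; on the `x_j`-chart: p699206 §3);
* §2 `hasSNCWith_boundary_readings_translate_chart_far` — on the re-centred `x_j`-chart the members of `E.map St ++ [E₁]` read
  hyperplanes and the quadrics `((yᵢ + bᵢ)·y_j + dᵢ)·𝒪` (`i ∈ fs ∖ {j}`), and by p701847 they are snc with `V(y_0, y_{S'})` as soon as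
  `dᵢ ≠ bᵢ·d_j` (`i ∈ fs ∩ S'`, `bᵢ ≠ 0`, `j ∈ fs`) and `dᵢ·b_k ≠ d_k·bᵢ` (`i ≠ k ∈ fs ∩ S'`, `bᵢ, b_k ≠ 0`);
* §3 `hasSNCWith_boundary_readings_shear_chart_far` — on a shear chart `x_l` (`l ∈ S ∖ S'`, `l ≠ j`) they read hyperplanes, sheared
  near members, `(y_j·y_l + d_j)·𝒪` and `((yᵢ + bᵢ·y_j)·y_l + dᵢ)·𝒪`, and by p702981 they are snc with `V(y_0, y_{S'})` under the same
  height conditions plus the near condition `|B| ≤ 1` (`{x_j = 0} ∈ E ⟹` no near member sheared into the centre; at most one such).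

The W-level statement (glue p692083 over the cover p688180) is the next file. Nothing here is a statement about resolution of
singularities in dimension ≥ 4 / characteristic `p` (NOT proved anywhere in this programme). bears_on: LADDER-RESOLUTION:D157-DOOR2
(res-dim4-pi). Supports stmt-ResolutionOfSingularities-16155 (helper, S3-N2 positive side with far members).
-/

-- every declaration of this summit lives under `Summit.ResolutionOfSingularities.ResolutionOfSingularities`
-- (summit = problem), which the duplicate-namespace linter flags; house convention (cf. the Target file).
set_option linter.dupNamespace false

noncomputable section

open MvPolynomial CategoryTheory AlgebraicGeometry Opposite TopologicalSpace
open AlgebraicGeometry.Scheme.IdealSheafData (ofIdealTop)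

namespace Summit.ResolutionOfSingularities.ResolutionOfSingularities.Theorems.PIDim4

open Literature.AlgebraicGeometry.Resolution
open Literature.AlgebraicGeometry.Resolution.AffinePointBlowup (P A γ coord Wtop ξ)

namespace ChartDictionary

variable {K : Type} [Field K]

/-! ## §1 Far members read on the shear chart `x_l` -/

section Readings

variable {S : Finset (Fin 4)} {j l : Fin 4} {b : Fin 4 → K} {Θ : A 4 K ≃ₐ[K] A 4 K}
  {τ : MvPolynomial (Fin 4) K ≃ₐ[K] MvPolynomial (Fin 4) K} {W : Scheme.{0}} {π : W ⟶ P 4 K}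

/-- **The far member `{x_l = -d}` (`d ≠ 0`) reads the translated hyperplane `(x_l + d)·𝒪` on the shear chart `x_l`** (parallel to
the exceptional component `{x_l = 0}`; `τ x_l = x_l`). -/
theorem comap_shear_chart_strictTransform_far_self (hl : l ∈ S) {dl : K} (hdl : dl ≠ 0)
    (hτ : ∀ k : Fin 4, Θ (X k.succ) = rename Fin.succ (τ (X k))) (hτl : τ (X l) = X l)
    (hπ : IsBlowup π (AffineCoordBlowup.𝓘Λ 4 K (insert 0 (Fin.succ '' (S : Set (Fin 4)))))) :
    (strictTransformIdeal π (AffineCoordBlowup.𝓘Λ 4 K (insert 0 (Fin.succ '' (S : Set (Fin 4)))))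
        (ofIdealTop (Ideal.span {(γ 4 K).symm (X l.succ + C dl)}))).comap
        (Spec.map (CommRingCat.ofHom (Θ : A 4 K →+* A 4 K)) ≫ AffineCoordBlowup.chartImm hπ (succ_mem_centreVars hl)) =
      ofIdealTop (Ideal.span {(γ 4 K).symm (X l.succ + C dl)}) := by
  classical
  have hC : Θ (C dl) = C dl := Θ.commutes dl
  have hΘl : Θ (X l.succ) = X l.succ := by rw [hτ l, hτl, rename_X]
  rw [Scheme.IdealSheafData.comap_comp, strictTransformIdeal_principal_comap_chartImm hl 0 (g := X l.succ + C dl) ?_ ?_ hπ,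
    comap_ofIdealTop_span_γ_symm, RingHom.coe_coe, map_add, hΘl, hC]
  · rw [map_add, coordBlowupSubst_X_self, coordBlowupSubst_C, pow_zero, one_mul]
  · refine not_coord_dvd_γ_symm_of_coeff 0 rfl ?_
    rw [coeff_add, coeff_zero_X, coeff_C, if_pos rfl, zero_add]
    exact hdl

/-- **The far member `{x_j = -d}` (`d ≠ 0`) reads the QUADRIC `(x_j·x_l + d)·𝒪` on the shear chart `x_l`** (`τ` fixes `x_j` and `x_l`). -/
theorem comap_shear_chart_strictTransform_far_j (hl : l ∈ S) (hj : j ∈ S) (hjl : j ≠ l) {dj : K} (hdj : dj ≠ 0)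
    (hτ : ∀ k : Fin 4, Θ (X k.succ) = rename Fin.succ (τ (X k))) (hτj : τ (X j) = X j) (hτl : τ (X l) = X l)
    (hπ : IsBlowup π (AffineCoordBlowup.𝓘Λ 4 K (insert 0 (Fin.succ '' (S : Set (Fin 4)))))) :
    (strictTransformIdeal π (AffineCoordBlowup.𝓘Λ 4 K (insert 0 (Fin.succ '' (S : Set (Fin 4)))))
        (ofIdealTop (Ideal.span {(γ 4 K).symm (X j.succ + C dj)}))).comap
        (Spec.map (CommRingCat.ofHom (Θ : A 4 K →+* A 4 K)) ≫ AffineCoordBlowup.chartImm hπ (succ_mem_centreVars hl)) =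
      ofIdealTop (Ideal.span {(γ 4 K).symm (X j.succ * X l.succ + C dj)}) := by
  classical
  have hC : Θ (C dj) = C dj := Θ.commutes dj
  have hΘl : Θ (X l.succ) = X l.succ := by rw [hτ l, hτl, rename_X]
  have hΘj : Θ (X j.succ) = X j.succ := by rw [hτ j, hτj, rename_X]
  rw [Scheme.IdealSheafData.comap_comp,
    strictTransformIdeal_principal_comap_chartImm hl 0 (g := X j.succ * X l.succ + C dj) ?_ ?_ hπ,
    comap_ofIdealTop_span_γ_symm, RingHom.coe_coe, map_add, map_mul, hΘj, hΘl, hC]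
  · rw [map_add, coordBlowupSubst_C,
      coordBlowupSubst_X_of_mem_of_ne K _ l.succ (succ_mem_centreVars hj) (fun e => hjl (Fin.succ_injective _ e)),
      pow_zero, one_mul, mul_comm]
  · refine not_coord_dvd_γ_symm_of_coeff 0 rfl ?_
    rw [coeff_add, coeff_C, if_pos rfl, coeff_X_mul', if_neg (by simp), zero_add]
    exact hdj

/-- **A far member `{xᵢ = -d}`, `i ∈ S ∖ {j, l}` (`d ≠ 0`), reads the QUADRIC `((xᵢ + bᵢ·x_j)·x_l + d)·𝒪` on the shear chart
`x_l`** (`τ xᵢ = xᵢ + bᵢ x_j`). -/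
theorem comap_shear_chart_strictTransform_far (hl : l ∈ S) {i : Fin 4} (hi : i ∈ S) (hil : i ≠ l) {di : K} (hdi : di ≠ 0)
    (hτ : ∀ k : Fin 4, Θ (X k.succ) = rename Fin.succ (τ (X k))) (hτi : τ (X i) = X i + C (b i) * X j) (hτl : τ (X l) = X l)
    (hπ : IsBlowup π (AffineCoordBlowup.𝓘Λ 4 K (insert 0 (Fin.succ '' (S : Set (Fin 4)))))) :
    (strictTransformIdeal π (AffineCoordBlowup.𝓘Λ 4 K (insert 0 (Fin.succ '' (S : Set (Fin 4)))))
        (ofIdealTop (Ideal.span {(γ 4 K).symm (X i.succ + C di)}))).comap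
        (Spec.map (CommRingCat.ofHom (Θ : A 4 K →+* A 4 K)) ≫ AffineCoordBlowup.chartImm hπ (succ_mem_centreVars hl)) =
      ofIdealTop (Ideal.span {(γ 4 K).symm ((X i.succ + C (b i) * X j.succ) * X l.succ + C di)}) := by
  classical
  have hC : Θ (C di) = C di := Θ.commutes di
  have hΘl : Θ (X l.succ) = X l.succ := by rw [hτ l, hτl, rename_X]
  have hΘi : Θ (X i.succ) = X i.succ + C (b i) * X j.succ := by
    rw [hτ i, hτi, map_add, map_mul, rename_X, rename_C, rename_X]
  rw [Scheme.IdealSheafData.comap_comp,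
    strictTransformIdeal_principal_comap_chartImm hl 0 (g := X i.succ * X l.succ + C di) ?_ ?_ hπ,
    comap_ofIdealTop_span_γ_symm, RingHom.coe_coe, map_add, map_mul, hΘi, hΘl, hC]
  · rw [map_add, coordBlowupSubst_C,
      coordBlowupSubst_X_of_mem_of_ne K _ l.succ (succ_mem_centreVars hi) (fun e => hil (Fin.succ_injective _ e)),
      pow_zero, one_mul, mul_comm]
  · refine not_coord_dvd_γ_symm_of_coeff 0 rfl ?_
    rw [coeff_add, coeff_C, if_pos rfl, coeff_X_mul', if_neg (by simp), zero_add]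
    exact hdi

end Readings


/-! ## §2 The `x_j`-chart: readings of the near/far boundary, and snc with the escaping centre -/

section TranslateChart

variable {S S' : Finset (Fin 4)} {j : Fin 4} {b : Fin 4 → K} {Θ : A 4 K ≃ₐ[K] A 4 K} {W : Scheme.{0}} {π : W ⟶ P 4 K}

/-- **THE TRANSFORMED NEAR/FAR BOUNDARY, READ ON THE RE-CENTRED `x_j`-CHART, IS SNC WITH THE ESCAPING CENTRE** when no far
hyperplane `{y_j = -d_j}` has the height of an active quadric and no two active quadrics share a height (p701847 fed with the
readings p697935 §1 / p699206 §3; `E₁` reads `y_j·𝒪`). -/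
theorem hasSNCWith_boundary_readings_translate_chart_far (hj : j ∈ S) (hjS' : j ∉ S') (hbj : b j = 0) (ms fs : List (Fin 4))
    (c d : Fin 4 → K) (hc : ∀ i ∈ S, c i = 0) (hfs : ∀ i ∈ fs, i ∈ S ∧ d i ≠ 0)
    (hs : ∀ i : Fin 4, Θ (X i.succ) = X i.succ + C (b i))
    (hH1 : ∀ i ∈ fs, i ∈ S' → b i ≠ 0 → j ∈ fs → d i ≠ b i * d j)
    (hH2 : ∀ i ∈ fs, ∀ k ∈ fs, i ≠ k → i ∈ S' → k ∈ S' → b i ≠ 0 → b k ≠ 0 → d i * b k ≠ d k * b i)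
    (hπ : IsBlowup π (AffineCoordBlowup.𝓘Λ 4 K (insert 0 (Fin.succ '' (S : Set (Fin 4)))))) :
    haveI : IsIso (CommRingCat.ofHom (Θ : A 4 K →+* A 4 K)) := (inferInstance : IsIso Θ.toRingEquiv.toCommRingCatIso.hom)
    HasSNCWith ((((ms.map fun i => ofIdealTop (Ideal.span {(γ 4 K).symm (X i.succ + C (c i))})) ++
        fs.map fun i => ofIdealTop (Ideal.span {(γ 4 K).symm (X i.succ + C (d i))})).map
        (strictTransformIdeal π (AffineCoordBlowup.𝓘Λ 4 K (insert 0 (Fin.succ '' (S : Set (Fin 4)))))) ++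
        [(AffineCoordBlowup.𝓘Λ 4 K (insert 0 (Fin.succ '' (S : Set (Fin 4))))).comap π]).map
        (·.comap (Spec.map (CommRingCat.ofHom (Θ : A 4 K →+* A 4 K)) ≫ AffineCoordBlowup.chartImm hπ (succ_mem_centreVars hj))))
      (AffineCoordBlowup.𝓘Λ 4 K (insert 0 (Fin.succ '' (S' : Set (Fin 4))))) := by
  classical
  haveI : IsIso (CommRingCat.ofHom (Θ : A 4 K →+* A 4 K)) := (inferInstance : IsIso Θ.toRingEquiv.toCommRingCatIso.hom)
  -- the hyperplane data and the quadric indices of the chart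
  let H : Finset (Fin (4 + 1) × K) :=
    insert (j.succ, (0 : K)) (ms.toFinset.image (fun i => (i.succ, b i + c i)) ∪ (if j ∈ fs then {(j.succ, d j)} else ∅))
  have hHmem : ∀ ka, ka ∈ H ↔ ka = (j.succ, (0 : K)) ∨ (∃ i ∈ ms, ka = (i.succ, b i + c i)) ∨ (j ∈ fs ∧ ka = (j.succ, d j)) := by
    intro ka
    simp only [H, Finset.mem_insert, Finset.mem_union, Finset.mem_image, List.mem_toFinset]
    refine or_congr Iff.rfl (or_congr ⟨fun ⟨i, hi, e⟩ => ⟨i, hi, e.symm⟩, fun ⟨i, hi, e⟩ => ⟨i, hi, e.symm⟩⟩ ?_)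
    by_cases hjfs : j ∈ fs
    · rw [if_pos hjfs, Finset.mem_singleton]; exact ⟨fun h => ⟨hjfs, h⟩, fun h => h.2⟩
    · rw [if_neg hjfs]; exact ⟨fun h => absurd h (Finset.notMem_empty _), fun h => absurd h.1 hjfs⟩
  refine hasSNCWith_𝓘Λ_of_forall_mem_far (K := K) (T := S') (j := j) (b := b) (d := d) hjS' H (fs.toFinset.erase j)
    (Finset.notMem_erase j _) (fun i hi => (hfs i (List.mem_toFinset.mp (Finset.mem_of_mem_erase hi))).2) ?_ ?_ ?_ ?_
  · -- (C1) a hyperplane of a quadric's index is the near member of that index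
    intro i hi a ha
    rcases (hHmem _).mp ha with e | ⟨i', hi', e⟩ | ⟨-, e⟩
    · exact absurd (Fin.succ_injective _ (Prod.mk.inj e).1) (Finset.ne_of_mem_erase hi)
    · obtain ⟨e1, e2⟩ := Prod.mk.inj e
      have hii' : i = i' := Fin.succ_injective _ e1
      subst hii'
      rw [e2, hc i (hfs i (List.mem_toFinset.mp (Finset.mem_of_mem_erase hi))).1, add_zero]
    · exact absurd (Fin.succ_injective _ (Prod.mk.inj e).1) (Finset.ne_of_mem_erase hi)
  · -- (C2) heights of far hyperplanes vs active quadrics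
    intro i hi hiS' hbi a ha
    have hifs : i ∈ fs := List.mem_toFinset.mp (Finset.mem_of_mem_erase hi)
    rcases (hHmem _).mp ha with e | ⟨i', hi', e⟩ | ⟨hjfs, e⟩
    · rw [(Prod.mk.inj e).2, zero_mul]; exact (hfs i hifs).2.symm
    · obtain ⟨e1, e2⟩ := Prod.mk.inj e
      have hji' : j = i' := Fin.succ_injective _ e1
      subst hji'
      rw [e2, hbj, hc j hj, add_zero, zero_mul]; exact (hfs i hifs).2.symm
    · rw [(Prod.mk.inj e).2, mul_comm]; exact (hH1 i hifs hiS' hbi hjfs).symm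
  · -- (C3) twin heights
    intro i hi k hk hik hiS' hkS' hbi hbk
    exact hH2 i (List.mem_toFinset.mp (Finset.mem_of_mem_erase hi)) k (List.mem_toFinset.mp (Finset.mem_of_mem_erase hk)) hik
      hiS' hkS' hbi hbk
  · -- the members
    intro D hD
    rw [List.map_append, List.map_map, List.mem_append, List.mem_map, List.map_singleton, List.mem_singleton] at hD
    rcases hD with ⟨D₀, hD₀, rfl⟩ | rfl
    · rcases List.mem_append.mp hD₀ with hD₀ | hD₀
      · -- near members
        obtain ⟨i, hi, rfl⟩ := List.mem_map.mp hD₀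
        simp only [Function.comp_apply]
        by_cases hij : i = j
        · subst hij
          left
          rw [hc i hj, C_0, add_zero, Scheme.IdealSheafData.comap_comp,
            show (γ 4 K).symm (X i.succ) = coord 4 K i.succ from rfl, strictTransformIdeal_hyperplane_self_comap_chartImm hj hπ,
            Scheme.IdealSheafData.comap_top]
        · right; left
          refine ⟨(i.succ, b i + c i), (hHmem _).mpr (Or.inr (Or.inl ⟨i, hi, rfl⟩)), ?_⟩
          rw [Scheme.IdealSheafData.comap_comp]
          by_cases hiS : i ∈ S
          · rw [hc i hiS, C_0, add_zero, add_zero, show (γ 4 K).symm (X i.succ) = coord 4 K i.succ from rfl,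
              strictTransformIdeal_hyperplane_comap_chartImm hj hij hπ,
              show coord 4 K i.succ = (γ 4 K).symm (X i.succ) from rfl, comap_ofIdealTop_span_γ_symm, RingHom.coe_coe, hs i]
          · have hC : Θ (C (c i)) = C (c i) := Θ.commutes (c i)
            rw [strictTransformIdeal_translate_comap_chartImm hj hiS (c i) hπ, comap_ofIdealTop_span_γ_symm, RingHom.coe_coe,
              map_add, hs i, hC, add_assoc, ← C_add]
      · -- far members
        obtain ⟨i, hi, rfl⟩ := List.mem_map.mp hD₀
        obtain ⟨hiS, hdi⟩ := hfs i hi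
        simp only [Function.comp_apply]
        by_cases hij : i = j
        · subst hij
          right; left
          refine ⟨(i.succ, d i), (hHmem _).mpr (Or.inr (Or.inr ⟨hi, rfl⟩)), ?_⟩
          rw [comap_recenter_chart_strictTransform_far_self hj hdi hs hπ, hbj, zero_add]
        · right; right
          refine ⟨i, Finset.mem_erase.mpr ⟨hij, List.mem_toFinset.mpr hi⟩, ?_⟩
          rw [comap_recenter_chart_strictTransform_far hj hiS hij hdi hs hπ, hbj, C_0, add_zero]
    · -- the exceptional component
      right; left
      refine ⟨(j.succ, 0), (hHmem _).mpr (Or.inl rfl), ?_⟩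
      rw [Scheme.IdealSheafData.comap_comp, comap_𝓘Λ_chartImm hj hπ, show coord 4 K j.succ = (γ 4 K).symm (X j.succ) from rfl,
        comap_ofIdealTop_span_γ_symm, RingHom.coe_coe, hs j, hbj]

end TranslateChart

/-! ## §3 A shear chart `x_l`: readings of the near/far boundary, and snc with the escaping centre -/

section ShearChart

variable {S S' : Finset (Fin 4)} {j l : Fin 4} {b : Fin 4 → K} {Θ : A 4 K ≃ₐ[K] A 4 K}
  {τ : MvPolynomial (Fin 4) K ≃ₐ[K] MvPolynomial (Fin 4) K} {W : Scheme.{0}} {π : W ⟶ P 4 K}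

/-- **THE TRANSFORMED NEAR/FAR BOUNDARY, READ ON A SHEAR CHART `x_l` (`l ∈ S ∖ S'`, `l ≠ j`), IS SNC WITH THE ESCAPING CENTRE
`V(y_0, y_{S'})`** when the near bad set has at most one element and no two active far members share a height (p702981 fed with
the dictionary p696282 and §1). -/
theorem hasSNCWith_boundary_readings_shear_chart_far (hl : l ∈ S) (hlS' : l ∉ S') (hj : j ∈ S) (hjS' : j ∉ S') (hjl : j ≠ l)
    (ms fs : List (Fin 4)) (c d : Fin 4 → K) (hc : ∀ i ∈ S, c i = 0) (hfs : ∀ i ∈ fs, i ∈ S ∧ d i ≠ 0)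
    (hτ : ∀ k : Fin 4, Θ (X k.succ) = rename Fin.succ (τ (X k))) (hτj : τ (X j) = X j) (hτl : τ (X l) = X l)
    (hτS : ∀ i ∈ S, i ≠ j → i ≠ l → τ (X i) = X i + C (b i) * X j) (hτk : ∀ k ∉ S, τ (X k) = X k + C (b k))
    (hB1 : j ∈ ms → ∀ m ∈ ms, m ∈ S → m ∈ S' → b m = 0)
    (hB2 : ∀ m ∈ ms, ∀ m' ∈ ms, m ∈ S → m' ∈ S → m ∈ S' → m' ∈ S' → b m ≠ 0 → b m' ≠ 0 → m = m')
    (hH1 : ∀ i ∈ fs, i ∈ S' → b i ≠ 0 → j ∈ fs → d i ≠ b i * d j)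
    (hH2 : ∀ i ∈ fs, ∀ k ∈ fs, i ≠ k → i ∈ S' → k ∈ S' → b i ≠ 0 → b k ≠ 0 → d i * b k ≠ d k * b i)
    (hπ : IsBlowup π (AffineCoordBlowup.𝓘Λ 4 K (insert 0 (Fin.succ '' (S : Set (Fin 4)))))) :
    haveI : IsIso (CommRingCat.ofHom (Θ : A 4 K →+* A 4 K)) := (inferInstance : IsIso Θ.toRingEquiv.toCommRingCatIso.hom)
    HasSNCWith ((((ms.map fun i => ofIdealTop (Ideal.span {(γ 4 K).symm (X i.succ + C (c i))})) ++
        fs.map fun i => ofIdealTop (Ideal.span {(γ 4 K).symm (X i.succ + C (d i))})).map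
        (strictTransformIdeal π (AffineCoordBlowup.𝓘Λ 4 K (insert 0 (Fin.succ '' (S : Set (Fin 4)))))) ++
        [(AffineCoordBlowup.𝓘Λ 4 K (insert 0 (Fin.succ '' (S : Set (Fin 4))))).comap π]).map
        (·.comap (Spec.map (CommRingCat.ofHom (Θ : A 4 K →+* A 4 K)) ≫ AffineCoordBlowup.chartImm hπ (succ_mem_centreVars hl))))
      (AffineCoordBlowup.𝓘Λ 4 K (insert 0 (Fin.succ '' (S' : Set (Fin 4))))) := by
  classical
  haveI : IsIso (CommRingCat.ofHom (Θ : A 4 K →+* A 4 K)) := (inferInstance : IsIso Θ.toRingEquiv.toCommRingCatIso.hom)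
  -- the hyperplane data, the sheared indices and the far quadric indices of the chart
  let H : Finset (Fin (4 + 1) × K) :=
    insert (l.succ, (0 : K)) ((if j ∈ ms then {(j.succ, (0 : K))} else ∅) ∪
      (ms.toFinset.filter (fun k => k ∉ S)).image (fun k => (k.succ, b k + c k)) ∪ (if l ∈ fs then {(l.succ, d l)} else ∅))
  have hHmem : ∀ ka, ka ∈ H ↔ ka = (l.succ, (0 : K)) ∨ (j ∈ ms ∧ ka = (j.succ, (0 : K))) ∨
      (∃ k ∈ ms, k ∉ S ∧ ka = (k.succ, b k + c k)) ∨ (l ∈ fs ∧ ka = (l.succ, d l)) := by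
    intro ka
    simp only [H, Finset.mem_insert, Finset.mem_union, Finset.mem_image, Finset.mem_filter, List.mem_toFinset]
    refine or_congr Iff.rfl ?_
    rw [or_assoc]
    refine or_congr ?_ (or_congr ⟨fun ⟨k, ⟨hk, hkS⟩, e⟩ => ⟨k, hk, hkS, e.symm⟩, fun ⟨k, hk, hkS, e⟩ => ⟨k, ⟨hk, hkS⟩, e.symm⟩⟩ ?_)
    · by_cases hjms : j ∈ ms
      · rw [if_pos hjms, Finset.mem_singleton]; exact ⟨fun h => ⟨hjms, h⟩, fun h => h.2⟩
      · rw [if_neg hjms]; exact ⟨fun h => absurd h (Finset.notMem_empty _), fun h => absurd h.1 hjms⟩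
    · by_cases hlfs : l ∈ fs
      · rw [if_pos hlfs, Finset.mem_singleton]; exact ⟨fun h => ⟨hlfs, h⟩, fun h => h.2⟩
      · rw [if_neg hlfs]; exact ⟨fun h => absurd h (Finset.notMem_empty _), fun h => absurd h.1 hlfs⟩
  let sh : Finset (Fin 4) := ms.toFinset.filter (fun m => m ∈ S ∧ m ≠ j ∧ m ≠ l)
  have hsh : ∀ m, m ∈ sh ↔ m ∈ ms ∧ m ∈ S ∧ m ≠ j ∧ m ≠ l := fun m => by
    simp only [sh, Finset.mem_filter, List.mem_toFinset]
  have hfsq : ∀ i, i ∈ fs.toFinset.erase l ↔ i ≠ l ∧ i ∈ fs := fun i => by rw [Finset.mem_erase, List.mem_toFinset]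
  refine hasSNCWith_𝓘Λ_of_forall_mem_far_shear (K := K) (T := S') (j := j) (l := l) (b := b) (d := d) hjS' hlS' hjl H sh
    (fs.toFinset.erase l) (fun h => ((hsh j).mp h).2.2.1 rfl) (fun h => ((hsh l).mp h).2.2.2 rfl) (Finset.notMem_erase l _)
    (fun i hi => (hfs i ((hfsq i).mp hi).2).2) ?_ ?_ ?_ ?_ ?_ ?_ ?_ ?_
  · -- hyperplanes of index `j` have constant `0`
    intro a ha
    rcases (hHmem _).mp ha with e | ⟨-, e⟩ | ⟨k, -, hkS, e⟩ | ⟨-, e⟩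
    · exact absurd (Fin.succ_injective _ (Prod.mk.inj e).1) hjl
    · exact (Prod.mk.inj e).2
    · exact absurd ((Fin.succ_injective _ (Prod.mk.inj e).1) ▸ hj) hkS
    · exact absurd (Fin.succ_injective _ (Prod.mk.inj e).1) hjl
  · -- no hyperplane of a sheared index
    intro m hm _ a ha
    obtain ⟨-, hmS, hmj, hml⟩ := (hsh m).mp hm
    rcases (hHmem _).mp ha with e | ⟨-, e⟩ | ⟨k, -, hkS, e⟩ | ⟨-, e⟩
    · exact hml (Fin.succ_injective _ (Prod.mk.inj e).1)
    · exact hmj (Fin.succ_injective _ (Prod.mk.inj e).1)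
    · exact hkS ((Fin.succ_injective _ (Prod.mk.inj e).1) ▸ hmS)
    · exact hml (Fin.succ_injective _ (Prod.mk.inj e).1)
  · -- no hyperplane of a far quadric index
    intro i hi hij a ha
    obtain ⟨hil, hifs⟩ := (hfsq i).mp hi
    rcases (hHmem _).mp ha with e | ⟨-, e⟩ | ⟨k, -, hkS, e⟩ | ⟨-, e⟩
    · exact absurd (Fin.succ_injective _ (Prod.mk.inj e).1) hil
    · exact absurd (Fin.succ_injective _ (Prod.mk.inj e).1) hij
    · exact absurd ((Fin.succ_injective _ (Prod.mk.inj e).1) ▸ (hfs i hifs).1) hkS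
    · exact absurd (Fin.succ_injective _ (Prod.mk.inj e).1) hil
  · -- `{x_j = 0}` an old member ⟹ nothing is sheared into the centre
    intro hmem m hm hmS'
    have hjms : j ∈ ms := by
      rcases (hHmem _).mp hmem with e | ⟨h, -⟩ | ⟨k, -, hkS, e⟩ | ⟨-, e⟩
      · exact absurd (Fin.succ_injective _ (Prod.mk.inj e).1) hjl
      · exact h
      · exact absurd ((Fin.succ_injective _ (Prod.mk.inj e).1) ▸ hj) hkS
      · exact absurd (Fin.succ_injective _ (Prod.mk.inj e).1) hjl
    obtain ⟨hmms, hmS, -, -⟩ := (hsh m).mp hm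
    exact hB1 hjms m hmms hmS hmS'
  · -- at most one member sheared into the centre
    intro m hm m' hm' hmS' hm'S' hbm hbm'
    obtain ⟨hmms, hmS, -, -⟩ := (hsh m).mp hm
    obtain ⟨hm'ms, hm'S, -, -⟩ := (hsh m').mp hm'
    exact hB2 m hmms m' hm'ms hmS hm'S hmS' hm'S' hbm hbm'
  · -- heights: `F_j` against an active `Fᵢ`
    intro i hi _ hiS' hbi hjfs
    exact hH1 i ((hfsq i).mp hi).2 hiS' hbi ((hfsq j).mp hjfs).2
  · -- heights: two active far quadrics
    intro i hi k hk _ _ hik hiS' hkS' hbi hbk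
    exact hH2 i ((hfsq i).mp hi).2 k ((hfsq k).mp hk).2 hik hiS' hkS' hbi hbk
  · -- the members
    intro D hD
    rw [List.map_append, List.map_map, List.mem_append, List.mem_map, List.map_singleton, List.mem_singleton] at hD
    rcases hD with ⟨D₀, hD₀, rfl⟩ | rfl
    · rcases List.mem_append.mp hD₀ with hD₀ | hD₀
      · -- near members (the dictionary p696282)
        obtain ⟨i, hi, rfl⟩ := List.mem_map.mp hD₀
        simp only [Function.comp_apply]
        by_cases hil : i = l
        · subst hil
          left
          rw [hc i hl, C_0, add_zero, show (γ 4 K).symm (X i.succ) = coord 4 K i.succ from rfl]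
          exact comap_shear_chart_strictTransform_hyperplane_self hl _ hπ
        · by_cases hiS : i ∈ S
          · rw [hc i hiS, C_0, add_zero, show (γ 4 K).symm (X i.succ) = coord 4 K i.succ from rfl]
            by_cases hij : i = j
            · subst hij
              right; left
              refine ⟨(i.succ, 0), (hHmem _).mpr (Or.inr (Or.inl ⟨hi, rfl⟩)), ?_⟩
              rw [C_0, add_zero]
              exact comap_shear_chart_strictTransform_hyperplane_j hl hjl hτ hτj hπ
            · right; right; left
              exact ⟨i, (hsh i).mpr ⟨hi, hiS, hij, hil⟩, comap_shear_chart_strictTransform_hyperplane_shear hl hil hτ (hτS i hiS hij hil) hπ⟩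
          · right; left
            exact ⟨(i.succ, b i + c i), (hHmem _).mpr (Or.inr (Or.inr (Or.inl ⟨i, hi, hiS, rfl⟩))),
              comap_shear_chart_strictTransform_translate hl hiS (c i) hτ (hτk i hiS) hπ⟩
      · -- far members (§1)
        obtain ⟨i, hi, rfl⟩ := List.mem_map.mp hD₀
        obtain ⟨hiS, hdi⟩ := hfs i hi
        simp only [Function.comp_apply]
        by_cases hil : i = l
        · subst hil
          right; left
          exact ⟨(i.succ, d i), (hHmem _).mpr (Or.inr (Or.inr (Or.inr ⟨hi, rfl⟩))),
            comap_shear_chart_strictTransform_far_self hl hdi hτ hτl hπ⟩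
        · by_cases hij : i = j
          · subst hij
            right; right; right; left
            exact ⟨(hfsq i).mpr ⟨hil, hi⟩, comap_shear_chart_strictTransform_far_j hl hj hjl hdi hτ hτj hτl hπ⟩
          · right; right; right; right
            exact ⟨i, (hfsq i).mpr ⟨hil, hi⟩, hij, comap_shear_chart_strictTransform_far hl hiS hil hdi hτ (hτS i hiS hij hil) hτl hπ⟩
    · -- the exceptional component
      right; left
      exact ⟨(l.succ, 0), (hHmem _).mpr (Or.inl rfl), comap_shear_chart_exceptional hl hτ hτl hπ⟩

end ShearChart

end ChartDictionary

end Summit.ResolutionOfSingularities.ResolutionOfSingularities.Theorems.PIDim4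

end
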